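import Literature.MathematicalPhysics.QuantumManyBody.PeriodicWeightedMaxFormSimplicity
import Literature.MathematicalPhysics.QuantumManyBody.PeriodicWeightedEnergy
import HarnessLib

/-!
# The pinned-scatterer form has a Ky Fan gap for integrable profiles (stub C2a of crux `CloudMomentumAtom`)

Helper file for the crux `Summit.AtomisticToContinuum.BoseEinsteinCondensation.Theses.BECProbeMassFlow.CloudMomentumAtom`
(item stmt-AtomisticToContinuum-12310), line `registered` (skeleton `Cruxes/CloudMomentumAtom/Lines/birth.lean`),
stub `stub_impurityKyFanGap_integrable` (C2a): for a repulsive finite-range profile `v` with `∫_{ℝ³} v(|x|) dx < ∞`,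
every `N ≥ 1` and `L > 0`, the pinned-scatterer form `impurityPeriodicEnergy v 0` — the quadratic form of
`H_N + V₀ = ∑ⱼ(-Δⱼ) + ∑_{i<j} v^per(xᵢ - xⱼ) + ∑ⱼ v^per(xⱼ)` on the torus `(ℝ³/Lℤ³)^N`, Bose sector — has a
spectral gap above its ground state in Ky Fan form: `2 E_imp + γ ≤ E_imp(Φ₁) + E_imp(Φ₂)` for some `γ > 0` and all
`L²(cell)`-orthogonal periodic trial pairs.

This is Reed–Simon IV Thm XIII.48 (a) (Faris–Simon) for the WEIGHT `W = ∑_{i<j} v^per(xᵢ - xⱼ) + ∑ⱼ v^per(xⱼ)`,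
which is measurable and integrable on the cell `[0,L)^{3N}` (`lintegral_cellN_periodicInteraction_ne_top_of_lintegral_ne_top`,
`lintegral_cellN_impurityInteraction_ne_top`): the abstract-weight Perron–Frobenius package of the tree
(`PeriodicWeightedEnergy.lean` … `PeriodicWeightedMaxFormSimplicity.lean`, the abstract-weight twin of the pair-only
package `PeriodicFormDomain.lean` … `PeriodicMaxFormSimplicity.lean`) gives the gap for `periodicEnergyW W`
(`exists_kyFanGap_periodicEnergyW`), and `impurityPeriodicEnergy v 0 = periodicEnergyW W`
(`impurityPeriodicEnergy_eq_periodicEnergyW`, `impurityPeriodicGroundStateEnergy_eq_periodicGroundStateEnergyW`).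
-/

noncomputable section

namespace Summit.AtomisticToContinuum.BoseEinsteinCondensation.Cruxes.CloudMomentumAtom.Birth

open MeasureTheory Filter
open scoped ENNReal NNReal ComplexConjugate BigOperators InnerProductSpace
open Literature.MathematicalPhysics.QuantumManyBody.BoseGas

variable {N : ℕ} {L : ℝ} {v : ℝ → ℝ≥0∞}

/-- **The pinned-scatterer weight `∑_{i<j} v^per(xᵢ - xⱼ) + ∑ⱼ v^per(xⱼ - x)` of an integrable profile is
integrable on the cell** `[0,L)^{3N}` (pair part: `C(N,2) L^{3(N-1)} ∫v`; one-body part: `N L^{3(N-1)} ∫v`).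
[folklore] -/
theorem lintegral_cellN_periodicInteraction_add_impurityInteraction_ne_top (hL : 0 < L) (hv : Measurable v)
    (hint : (∫⁻ y : Space, v ‖y‖) ≠ ⊤) (x : Space) (N : ℕ) :
    ∫⁻ X in cellN N L, (periodicInteraction v L + impurityInteraction v L x : Config N → ℝ≥0∞) X ≠ ⊤ := by
  simp only [Pi.add_apply]
  rw [lintegral_add_right _ (measurable_impurityInteraction hv L x)]
  exact ENNReal.add_ne_top.2 ⟨lintegral_cellN_periodicInteraction_ne_top_of_lintegral_ne_top hL hv hint N,
    lintegral_cellN_impurityInteraction_ne_top hL hv hint x N⟩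

/-- **A Ky Fan gap of the pinned-scatterer form at any scatterer position** (integrable profile, `N ≥ 1`,
`L > 0`): `∃ γ > 0`, `2 E_imp(N,L,x) + γ ≤ impurityPeriodicEnergy v x Φ₁ + impurityPeriodicEnergy v x Φ₂` for all
`L²(cell)`-orthogonal periodic trial pairs — Reed–Simon IV Thm XIII.48 (a) for the weight
`∑_{i<j} v^per(xᵢ - xⱼ) + ∑ⱼ v^per(xⱼ - x) ∈ L¹` of the cell (`exists_kyFanGap_periodicEnergyW`).
[cite: ReedSimonIV1978, Thm XIII.48 (a) and Thm XIII.1–2] -/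
theorem exists_kyFanGap_impurityPeriodicEnergy (hv : Measurable v) (hint : (∫⁻ y : Space, v ‖y‖) ≠ ⊤)
    (hN : 1 ≤ N) (hL : 0 < L) (x : Space) :
    ∃ γ : ℝ, 0 < γ ∧ ∀ Φ₁ Φ₂ : PeriodicTrialState N L,
      ∫ X in cellN N L, conj (Φ₁.ψ X) * Φ₂.ψ X = 0 →
        2 * impurityPeriodicGroundStateEnergy v N L x + ENNReal.ofReal γ ≤
          impurityPeriodicEnergy v x Φ₁ + impurityPeriodicEnergy v x Φ₂ := by
  have hWm : Measurable (periodicInteraction (N := N) v L + impurityInteraction v L x) :=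
    measurable_periodicInteraction_add_impurityInteraction hv L x
  have hW : ∫⁻ X in cellN N L, (periodicInteraction v L + impurityInteraction v L x : Config N → ℝ≥0∞) X ≠ ⊤ :=
    lintegral_cellN_periodicInteraction_add_impurityInteraction_ne_top hL hv hint x N
  obtain ⟨γ, hγ, hgap⟩ := exists_kyFanGap_periodicEnergyW hN hL hWm hW
  refine ⟨γ, hγ, fun Φ₁ Φ₂ horth => ?_⟩
  rw [impurityPeriodicGroundStateEnergy_eq_periodicGroundStateEnergyW hv, impurityPeriodicEnergy_eq_periodicEnergyW hv,
    impurityPeriodicEnergy_eq_periodicEnergyW hv]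
  exact hgap Φ₁ Φ₂ horth

/-- **Stub C2a of the registered line of crux `CloudMomentumAtom`: the pinned-scatterer form of an INTEGRABLE
repulsive finite-range profile has a Ky Fan gap above its ground state**, for every `N ≥ 1` and `L > 0`
(Reed–Simon IV Thm XIII.48 (a) on the torus for the weight `∑_{i<j} v^per(xᵢ - xⱼ) + ∑ⱼ v^per(xⱼ)`, via the
abstract-weight max-form Perron–Frobenius package). [cite: ReedSimonIV1978, Thm XIII.48 (a)] -/
theorem stub_impurityKyFanGap_integrable : ∀ (v : ℝ → ℝ≥0∞), IsRepulsiveFiniteRange v → (∫⁻ x : Space, v ‖x‖) ≠ ⊤ → ∀ (N : ℕ) (L : ℝ), 1 ≤ N → 0 < L → ∃ γ : ℝ, 0 < γ ∧ ∀ Φ₁ Φ₂ : PeriodicTrialState N L, ∫ X in cellN N L, conj (Φ₁.ψ X) * Φ₂.ψ X = 0 → 2 * impurityPeriodicGroundStateEnergy v N L 0 + ENNReal.ofReal γ ≤ impurityPeriodicEnergy v 0 Φ₁ + impurityPeriodicEnergy v 0 Φ₂ :=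
  fun _ hv hint _ _ hN hL => exists_kyFanGap_impurityPeriodicEnergy hv.1 hint hN hL 0

end Summit.AtomisticToContinuum.BoseEinsteinCondensation.Cruxes.CloudMomentumAtom.Birth

end
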